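import Summits.AnomalousDissipation.AnomalousDissipation.Theorems.SawtoothPulseCascadeK1LocalisedCascadeStripBlocks
import Summits.AnomalousDissipation.AnomalousDissipation.Theorems.SawtoothPulseCascadeK1LocalisedCascadeCanonicalBlocks
import Summits.AnomalousDissipation.AnomalousDissipation.Theorems.SawtoothPulseCascadeK1LocalisedCascadeBlockJunk

/-!
# K1loc, line `Spectral` / thin start — helper: THE STRIP AND LOW-FIBRE STEPS ON CANONICAL BLOCKS (closed-form junk; a handful of scalars per phase)

Helper file of the prover lane on the crux `K1LocalisedCascade` (stmt-AnomalousDissipation-19491), route `SawtoothPulseCascade`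
(S-B/S-C assembly seat; the LEDGER ASSEMBLY, concrete layer).  Each class step of the fibre ledger (`…RatioBlocks`: O-V, A-V, C-H,
B-H; `…StripBlocks`: S-V, T-H) on the CANONICAL geometry of `…CanonicalBlocks` (blocks `Λ_m = Λ₀2^m`, `m < M_b`; cut-offs
`Q₂^m = ⌊q_nΛ_m/q_d⌋`, `Q₁^m = ⌊2u′Λ_m/v′⌋ + E`; envelope scale `d₀^m = 8τ_m/A_m + Mδ_j/(πN_j)` and zone depth
`M = max 1 √(2 log(1/η))` of `…LedgerArith`; rounding allowance `ε₀^m = A_m·2π(Λ_{m+1}G)e^{−M²/2}/(2N_j)`), with the junk summed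
in closed form by `…BlockJunk`:
  `class ≤ (√J + √feed)² + ((1+γ)^{2j′}/(Λ₀2^{M_b}))²`,
  `J = 3r*²·((4/3)(A*πGηΛ₀2^{M_b}/N_j)² + 128·N_j·A*·τ₀ + 8·M_b·A*²·Mδ_j/π)`,
where `(r*, A*, τ₀)` are the explicit block constants of `…CanonicalBlocks`.  Hypotheses per step: the class/feed slopes, `Λ₀`,
`E`, `M_b`, `η`, and FOUR scalar inequalities (margin below the shift, separation of the cut-offs, fibre floor vs. class threshold,
`Mδ_j < π/2`).  This file: `strip_vstep_canonical_le` (S-V; low fibres `|k₁| < Λ₀` exact) and `lowFibre_hstep_canonical_le` (T-H;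
fibres `|k₀| < Λ₀` exact); the ratio classes are in `…CanonicalRatioSteps`.  No definitions; no statement about the crux.
[cite: Grafakos2014, Prop. 3.1.2 (5), Prop. 3.2.7 (3), §3.1.3] [cite: ElgindiLissMattingly2025, §1 (slope ±1 branches)] [problem: turb]
-/

-- `Summit.<Summit>.<Problem>`: single-conjunct summit, the duplicate namespace segment is deliberate.
set_option linter.dupNamespace false

noncomputable section

namespace Summit.AnomalousDissipation.AnomalousDissipation.Theorems.SawtoothPulseCascade.K1Window

open MeasureTheory Set Filter Topology UnitAddTorus Function Complex Metric
open scoped Real ENNReal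
open Literature.Analysis Literature.Analysis.FunctionSpaces Literature.Analysis.FunctionSpaces.Torus Literature.Analysis.FluidPDE
open Literature.Analysis.FluidPDE.ShearStage
open Literature.Analysis.FluidPDE.SawtoothCascade Literature.Analysis.FluidPDE.SawtoothCascade.CascadeParams
open Summit.AnomalousDissipation.AnomalousDissipation.Theorems.SawtoothPulseCascade.K1Start
open Summit.AnomalousDissipation.AnomalousDissipation.Theorems.SawtoothPulseCascade.K1Flat
open Summit.AnomalousDissipation.AnomalousDissipation.Theorems.SawtoothPulseCascade.K1Ledger.From

/-- The same with an exact pass-through term in front: `x ≤ T + ((√S + √F)² + f)` and `S ≤ S'` give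
`x ≤ T + ((√S' + √F)² + f)`. [folklore] -/
theorem le_add_sq_sqrt_add_mono {x T S S' F f : ℝ} (h : x ≤ T + ((Real.sqrt S + Real.sqrt F) ^ 2 + f)) (hS : S ≤ S') :
    x ≤ T + ((Real.sqrt S' + Real.sqrt F) ^ 2 + f) :=
  h.trans (add_le_add le_rfl (add_le_add (pow_le_pow_left₀ (add_nonneg (Real.sqrt_nonneg _) (Real.sqrt_nonneg _))
    (add_le_add (Real.sqrt_le_sqrt hS) le_rfl) 2) le_rfl))

section Cascade

variable (P : CascadeParams)

/-! ## §1 The strip (S-V) and the low fibres (T-H) on canonical blocks -/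

/-- **(S-V) ON CANONICAL BLOCKS.**  The strip `Σ'[|k₀| < K]‖𝓕a_{j+1}‖²`: the low fibres `|k₁| < Λ₀` pass exactly, the chopped
fibres are cut into canonical blocks from the floor `Λ₀ ≥ 1` with margin `q_n/q_d`, `Kq_d + q_nΛ₀ < Gq_dΛ₀`; feed slope `(u′, v′)`
(`v′ > 0`), offset `E` with the separation `2u′q_dΛ₀ + (E+2)q_dv′ ≤ q_nv′Λ₀`, `M_b` blocks, rounding target `η > 0` with
`max(1,√(2log(1/η)))·δ_j < π/2`.  Then `strip ≤ Σ'[|k₁| < Λ₀]‖𝓕b_j‖² + ((√J + √(Σ'[E+1 ≤ |k₀| ∧ u′|k₁| ≤ v′|k₀|]‖𝓕b_j‖²))² +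
((1+γ)^{2(j+1)}/(Λ₀2^{M_b}))²)` with `J` as in the file header, `r* = ((2u′/v′ + q_n/q_d)Λ₀ + E+1)/((q_n/q_d − 2u′/v′)Λ₀ − (E+1))`,
`A* = (Kq_d + (q_n + Gq_d)Λ₀)/((Gq_d − q_n)Λ₀ − Kq_d)`, `τ₀ = πq_d/((Gq_d − q_n)Λ₀ − Kq_d)`. [cite: Grafakos2014, Prop. 3.1.2 (5), Prop. 3.2.7 (3), §3.1.3] -/
theorem strip_vstep_canonical_le {G : ℕ} (hγ : P.γ = G) (hδ₀ : 0 < P.δ₀) (hd : 0 < P.d) (hN₀ : 1 ≤ P.N₀)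
    (hρN : 1 ≤ P.ρN) (a b : ℕ → UnitAddTorus (Fin 2) → ℝ) (has : ∀ j, IsSmooth (a j)) (h0 : a 0 = datum)
    (hb : ∀ j, b j = a j ∘ shearMap 0 1 (amp ⟨P.U j, P.U_periodic j, P.contDiff_U (P.δ_pos hδ₀ hd j)⟩ P.γ))
    (hab : ∀ j, a (j + 1) = b j ∘ shearMap 1 0 (amp ⟨P.U j, P.U_periodic j, P.contDiff_U (P.δ_pos hδ₀ hd j)⟩ P.γ))
    (j : ℕ) {K u' v' qn qd Λ0 E : ℕ} (hv' : 0 < v') (hqd : 0 < qd)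
    (hK : K * qd + qn * Λ0 < G * qd * Λ0) (hΛ0 : 1 ≤ Λ0)
    (hsep : 2 * u' * qd * Λ0 + (E + 2) * qd * v' ≤ qn * v' * Λ0) (Mb : ℕ) {η : ℝ} (hη : 0 < η)
    (hMδ : max 1 (Real.sqrt (2 * Real.log (1 / η))) * P.δ j < π / 2) :
    ∑' k : Fin 2 → ℤ, (if |k 0| < (K : ℤ) then (1 : ℝ) else 0) * ‖mFourierCoeff (fun x => (a (j + 1) x : ℂ)) k‖ ^ 2 ≤
      ∑' k : Fin 2 → ℤ, (if |k 1| < (Λ0 : ℤ) then (1 : ℝ) else 0) * ‖mFourierCoeff (fun x => (b j x : ℂ)) k‖ ^ 2 +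
      ((Real.sqrt (3 * (((2 * (u' : ℝ) / v' + (qn : ℝ) / qd) * Λ0 + (E + 1)) /
              (((qn : ℝ) / qd - 2 * (u' : ℝ) / v') * Λ0 - (E + 1))) ^ 2 *
            (4 / 3 * ((((K : ℝ) * qd + ((qn : ℝ) + G * qd) * Λ0) / (((G : ℝ) * qd - qn) * Λ0 - K * qd)) * π * G * η * Λ0 /
                P.N j * 2 ^ Mb) ^ 2 +
              128 * P.N j * (((K : ℝ) * qd + ((qn : ℝ) + G * qd) * Λ0) / (((G : ℝ) * qd - qn) * Λ0 - K * qd)) *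
                (π * qd / (((G : ℝ) * qd - qn) * Λ0 - K * qd)) +
              8 * Mb * (((K : ℝ) * qd + ((qn : ℝ) + G * qd) * Λ0) / (((G : ℝ) * qd - qn) * Λ0 - K * qd)) ^ 2 *
                (max 1 (Real.sqrt (2 * Real.log (1 / η))) * P.δ j) / π)) +
          Real.sqrt (∑' k : Fin 2 → ℤ, (if ((E + 1 : ℕ) : ℤ) ≤ |k 0| ∧ (u' : ℤ) * |k 1| ≤ (v' : ℤ) * |k 0| then (1 : ℝ) else 0) *
            ‖mFourierCoeff (fun x => (b j x : ℂ)) k‖ ^ 2)) ^ 2 +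
        ((1 + P.γ) ^ (2 * (j + 1)) / ((Λ0 * 2 ^ Mb : ℕ) : ℝ)) ^ 2) := by
  -- the canonical data
  set M : ℝ := max 1 (Real.sqrt (2 * Real.log (1 / η))) with hMdef
  have hM : 1 ≤ M := (zoneDepth_facts hη).1
  have hMη : Real.exp (-(M ^ 2 / 2)) ≤ η := (zoneDepth_facts hη).2
  have hN : (0 : ℝ) < P.N j := by exact_mod_cast P.N_pos hN₀ hρN j
  have hδ : 0 < P.δ j := P.δ_pos hδ₀ hd j
  have hMδ0 : 0 < M * P.δ j := mul_pos (by linarith) hδ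
  set Λb : ℕ → ℕ := fun m => Λ0 * 2 ^ m with hΛb
  set Q₁ : ℕ → ℕ := fun m => 2 * u' * (Λ0 * 2 ^ m) / v' + E with hQ₁
  set Q₂ : ℕ → ℕ := fun m => qn * (Λ0 * 2 ^ m) / qd with hQ₂
  set A : ℕ → ℝ := fun m => (((K + Q₂ m : ℕ) : ℝ) + ((Λb m * G : ℕ) : ℝ)) /
    (((Λb m * G : ℕ) : ℝ) - ((K + Q₂ m : ℕ) : ℝ)) with hA
  set τ : ℕ → ℝ := fun m => π / (((Λb m * G : ℕ) : ℝ) - ((K + Q₂ m : ℕ) : ℝ)) with hτ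
  set As : ℝ := ((K : ℝ) * qd + ((qn : ℝ) + G * qd) * Λ0) / (((G : ℝ) * qd - qn) * Λ0 - K * qd) with hAs
  set τ₀ : ℝ := π * qd / (((G : ℝ) * qd - qn) * Λ0 - K * qd) with hτ₀
  set rs : ℝ := ((2 * (u' : ℝ) / v' + (qn : ℝ) / qd) * Λ0 + (E + 1)) / (((qn : ℝ) / qd - 2 * (u' : ℝ) / v') * Λ0 - (E + 1))
    with hrs
  have hΛge : ∀ m, 1 ≤ Λ0 * 2 ^ m := fun m => hΛ0.trans (canon_blocks_ge Λ0 m)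
  have hAfacts : ∀ m, 0 < A m ∧ A m ≤ As := fun m => canon_strip_A_le hqd hK (canon_blocks_ge Λ0 m)
  have hτfacts : ∀ m, 0 ≤ τ m ∧ τ m ≤ τ₀ / 2 ^ m := fun m => canon_strip_tau_le hqd hK m
  have hΛQ : ∀ m, K + Q₂ m < Λb m * G := fun m => canon_strip_shift hK (canon_blocks_ge Λ0 m)
  have hτpos : ∀ m, 0 < τ m := fun m =>
    div_pos Real.pi_pos (canon_strip_den_pos hK (canon_blocks_ge Λ0 m))
  set d₀ : ℕ → ℝ := fun m => 8 * τ m / A m + M * P.δ j / (Real.pi * P.N j) with hd₀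
  have hdfacts : ∀ m, 0 < d₀ m ∧ M * P.δ j < Real.pi * P.N j * d₀ m ∧ 8 * τ m ≤ A m * d₀ m := fun m =>
    envelopeScale_facts (hAfacts m).1 (hτpos m) hN hMδ0
  set ε₀ : ℕ → ℝ := fun m => A m * (2 * π * ((Λb (m + 1) * G : ℕ) : ℝ) * (Real.exp (-(M ^ 2 / 2)) / (2 * P.N j))) with hε₀
  have hε0 : ∀ m, 0 ≤ ε₀ m := fun m => by
    have := (hAfacts m).1.le
    positivity
  -- the multi-block step
  have hstep := tsum_strip_vstep_blocks_le P hγ hδ₀ hd hN₀ hρN a b has h0 hb hab j K Λb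
    (canon_blocks_monotone Λ0) (by simpa [hΛb] using hΛ0) Mb Q₁ Q₂
    (fun m => canon_Q₁_lt_Q₂ hv' hqd hsep (canon_blocks_ge Λ0 m)) hΛQ hM hMδ d₀ ε₀ (fun m => (hdfacts m).1)
    (fun m => (hdfacts m).2.1) (fun m => (hdfacts m).2.2) hε0 (fun m => le_rfl) (u' := u') (v' := v') (Y := E + 1)
    (fun m => canon_feed hv' E Λ0 m) (fun m => by simp [hQ₁])
  -- the junk in closed form
  have hjunk := blockJunk_sum_le (r := fun m => ((Q₁ m : ℝ) + Q₂ m) / ((Q₂ m : ℝ) - Q₁ m)) (A := A) (τ := τ) (ε₀ := ε₀)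
    (rs := rs) (As := As) (τ₀ := τ₀) (e₀ := As * π * G * η * Λ0 / P.N j) (N := (P.N j : ℝ)) (Mδ := M * P.δ j)
    hN hMδ0.le (by
      have := (hτfacts 0).2; have := (hτfacts 0).1
      have h : τ 0 ≤ τ₀ / 2 ^ 0 := (hτfacts 0).2
      simp at h; linarith)
    (fun m => canon_r_nonneg (canon_Q₁_lt_Q₂ hv' hqd hsep (canon_blocks_ge Λ0 m)))
    (fun m => canon_r_le hv' hqd hsep (canon_blocks_ge Λ0 m)) (fun m => (hAfacts m).1) (fun m => (hAfacts m).2)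
    (fun m => (hτfacts m).1) (fun m => (hτfacts m).2) hε0 (fun m => ?_) Mb
  · -- assemble
    have e2N : ((2 * P.N j : ℕ) : ℝ) = 2 * (P.N j : ℝ) := by push_cast; ring
    rw [e2N] at hstep
    have e0 : Λb 0 = Λ0 := by simp [hΛb]
    rw [e0] at hstep
    exact le_add_sq_sqrt_add_mono hstep hjunk
  · -- the rounding allowance on block `m`
    simp only [hε₀]
    have hA' := (hAfacts m).2
    have hA0' := (hAfacts m).1.le
    have eΛ : ((Λb (m + 1) * G : ℕ) : ℝ) = (Λ0 : ℝ) * 2 ^ (m + 1) * G := by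
      show ((Λ0 * 2 ^ (m + 1) * G : ℕ) : ℝ) = _
      push_cast; ring
    rw [eΛ]
    have hAs0 : 0 ≤ As := hA0'.trans hA'
    calc A m * (2 * π * ((Λ0 : ℝ) * 2 ^ (m + 1) * G) * (Real.exp (-(M ^ 2 / 2)) / (2 * P.N j)))
        = A m * Real.exp (-(M ^ 2 / 2)) * (π * G * Λ0 / P.N j * 2 ^ (m + 1)) := by
          field_simp
      _ ≤ As * η * (π * G * Λ0 / P.N j * 2 ^ (m + 1)) :=
          mul_le_mul_of_nonneg_right (mul_le_mul hA' hMη (Real.exp_nonneg _) hAs0) (by positivity)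
      _ = As * π * G * η * Λ0 / P.N j * 2 ^ (m + 1) := by ring


/-- **(T-H) ON CANONICAL BLOCKS.**  The low fibres `Σ'[|k₁| < K]‖𝓕b_j‖²`: the fibres `|k₀| < Λ₀` pass exactly, the chopped
fibres `k₀` are cut into canonical blocks from the floor `Λ₀ ≥ 1` (the strip threshold of `a_j`) with margin `q_n/q_d`,
`Kq_d + q_nΛ₀ < Gq_dΛ₀`; feed = the off-cone class `Σ'[Λ₀ ≤ |k₀| ∧ u′|k₀| ≤ v′|k₁|]‖𝓕a_j‖²` (`v′ > 0`), offset `E` with the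
separation `2u′q_dΛ₀ + (E+2)q_dv′ ≤ q_nv′Λ₀`, `M_b` blocks, rounding target `η > 0` with `max(1,√(2log(1/η)))·δ_j < π/2`.  Then
`T ≤ Σ'[|k₀| < Λ₀]‖𝓕a_j‖² + ((√J + √feed)² + ((1+γ)^{2j}/(Λ₀2^{M_b}))²)` with `J` as in the file header, `r* = ((2u′/v′ + q_n/q_d)Λ₀ + E+1)/((q_n/q_d − 2u′/v′)Λ₀ − (E+1))`,
`A* = (Kq_d + (q_n + Gq_d)Λ₀)/((Gq_d − q_n)Λ₀ − Kq_d)`, `τ₀ = πq_d/((Gq_d − q_n)Λ₀ − Kq_d)`. [cite: Grafakos2014, Prop. 3.1.2 (5), Prop. 3.2.7 (3), §3.1.3] -/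
theorem lowFibre_hstep_canonical_le {G : ℕ} (hγ : P.γ = G) (hδ₀ : 0 < P.δ₀) (hd : 0 < P.d) (hN₀ : 1 ≤ P.N₀)
    (hρN : 1 ≤ P.ρN) (a b : ℕ → UnitAddTorus (Fin 2) → ℝ) (has : ∀ j, IsSmooth (a j)) (h0 : a 0 = datum)
    (hb : ∀ j, b j = a j ∘ shearMap 0 1 (amp ⟨P.U j, P.U_periodic j, P.contDiff_U (P.δ_pos hδ₀ hd j)⟩ P.γ))
    (hab : ∀ j, a (j + 1) = b j ∘ shearMap 1 0 (amp ⟨P.U j, P.U_periodic j, P.contDiff_U (P.δ_pos hδ₀ hd j)⟩ P.γ))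
    (j : ℕ) {K u' v' qn qd Λ0 E : ℕ} (hv' : 0 < v') (hqd : 0 < qd)
    (hK : K * qd + qn * Λ0 < G * qd * Λ0) (hΛ0 : 1 ≤ Λ0)
    (hsep : 2 * u' * qd * Λ0 + (E + 2) * qd * v' ≤ qn * v' * Λ0) (Mb : ℕ) {η : ℝ} (hη : 0 < η)
    (hMδ : max 1 (Real.sqrt (2 * Real.log (1 / η))) * P.δ j < π / 2) :
    ∑' k : Fin 2 → ℤ, (if |k 1| < (K : ℤ) then (1 : ℝ) else 0) * ‖mFourierCoeff (fun x => (b j x : ℂ)) k‖ ^ 2 ≤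
      ∑' k : Fin 2 → ℤ, (if |k 0| < (Λ0 : ℤ) then (1 : ℝ) else 0) * ‖mFourierCoeff (fun x => (a j x : ℂ)) k‖ ^ 2 +
      ((Real.sqrt (3 * (((2 * (u' : ℝ) / v' + (qn : ℝ) / qd) * Λ0 + (E + 1)) /
              (((qn : ℝ) / qd - 2 * (u' : ℝ) / v') * Λ0 - (E + 1))) ^ 2 *
            (4 / 3 * ((((K : ℝ) * qd + ((qn : ℝ) + G * qd) * Λ0) / (((G : ℝ) * qd - qn) * Λ0 - K * qd)) * π * G * η * Λ0 /
                P.N j * 2 ^ Mb) ^ 2 +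
              128 * P.N j * (((K : ℝ) * qd + ((qn : ℝ) + G * qd) * Λ0) / (((G : ℝ) * qd - qn) * Λ0 - K * qd)) *
                (π * qd / (((G : ℝ) * qd - qn) * Λ0 - K * qd)) +
              8 * Mb * (((K : ℝ) * qd + ((qn : ℝ) + G * qd) * Λ0) / (((G : ℝ) * qd - qn) * Λ0 - K * qd)) ^ 2 *
                (max 1 (Real.sqrt (2 * Real.log (1 / η))) * P.δ j) / π)) +
          Real.sqrt (∑' k : Fin 2 → ℤ, (if (Λ0 : ℤ) ≤ |k 0| ∧ (u' : ℤ) * |k 0| ≤ (v' : ℤ) * |k 1| then (1 : ℝ) else 0) *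
            ‖mFourierCoeff (fun x => (a j x : ℂ)) k‖ ^ 2)) ^ 2 +
        ((1 + P.γ) ^ (2 * j) / ((Λ0 * 2 ^ Mb : ℕ) : ℝ)) ^ 2) := by
  -- the canonical data
  set M : ℝ := max 1 (Real.sqrt (2 * Real.log (1 / η))) with hMdef
  have hM : 1 ≤ M := (zoneDepth_facts hη).1
  have hMη : Real.exp (-(M ^ 2 / 2)) ≤ η := (zoneDepth_facts hη).2
  have hN : (0 : ℝ) < P.N j := by exact_mod_cast P.N_pos hN₀ hρN j
  have hδ : 0 < P.δ j := P.δ_pos hδ₀ hd j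
  have hMδ0 : 0 < M * P.δ j := mul_pos (by linarith) hδ
  set Λb : ℕ → ℕ := fun m => Λ0 * 2 ^ m with hΛb
  set Q₁ : ℕ → ℕ := fun m => 2 * u' * (Λ0 * 2 ^ m) / v' + E with hQ₁
  set Q₂ : ℕ → ℕ := fun m => qn * (Λ0 * 2 ^ m) / qd with hQ₂
  set A : ℕ → ℝ := fun m => (((K + Q₂ m : ℕ) : ℝ) + ((Λb m * G : ℕ) : ℝ)) /
    (((Λb m * G : ℕ) : ℝ) - ((K + Q₂ m : ℕ) : ℝ)) with hA
  set τ : ℕ → ℝ := fun m => π / (((Λb m * G : ℕ) : ℝ) - ((K + Q₂ m : ℕ) : ℝ)) with hτ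
  set As : ℝ := ((K : ℝ) * qd + ((qn : ℝ) + G * qd) * Λ0) / (((G : ℝ) * qd - qn) * Λ0 - K * qd) with hAs
  set τ₀ : ℝ := π * qd / (((G : ℝ) * qd - qn) * Λ0 - K * qd) with hτ₀
  set rs : ℝ := ((2 * (u' : ℝ) / v' + (qn : ℝ) / qd) * Λ0 + (E + 1)) / (((qn : ℝ) / qd - 2 * (u' : ℝ) / v') * Λ0 - (E + 1))
    with hrs
  have hΛge : ∀ m, 1 ≤ Λ0 * 2 ^ m := fun m => hΛ0.trans (canon_blocks_ge Λ0 m)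
  have hAfacts : ∀ m, 0 < A m ∧ A m ≤ As := fun m => canon_strip_A_le hqd hK (canon_blocks_ge Λ0 m)
  have hτfacts : ∀ m, 0 ≤ τ m ∧ τ m ≤ τ₀ / 2 ^ m := fun m => canon_strip_tau_le hqd hK m
  have hΛQ : ∀ m, K + Q₂ m < Λb m * G := fun m => canon_strip_shift hK (canon_blocks_ge Λ0 m)
  have hτpos : ∀ m, 0 < τ m := fun m =>
    div_pos Real.pi_pos (canon_strip_den_pos hK (canon_blocks_ge Λ0 m))
  set d₀ : ℕ → ℝ := fun m => 8 * τ m / A m + M * P.δ j / (Real.pi * P.N j) with hd₀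
  have hdfacts : ∀ m, 0 < d₀ m ∧ M * P.δ j < Real.pi * P.N j * d₀ m ∧ 8 * τ m ≤ A m * d₀ m := fun m =>
    envelopeScale_facts (hAfacts m).1 (hτpos m) hN hMδ0
  set ε₀ : ℕ → ℝ := fun m => A m * (2 * π * ((Λb (m + 1) * G : ℕ) : ℝ) * (Real.exp (-(M ^ 2 / 2)) / (2 * P.N j))) with hε₀
  have hε0 : ∀ m, 0 ≤ ε₀ m := fun m => by
    have := (hAfacts m).1.le
    positivity
  -- the multi-block step
  have hstep := tsum_lowFibre_hstep_blocks_le P hγ hδ₀ hd hN₀ hρN a b has h0 hb hab j K Λb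
    (canon_blocks_monotone Λ0) (by simpa [hΛb] using hΛ0) Mb Q₁ Q₂
    (fun m => canon_Q₁_lt_Q₂ hv' hqd hsep (canon_blocks_ge Λ0 m)) hΛQ hM hMδ d₀ ε₀ (fun m => (hdfacts m).1)
    (fun m => (hdfacts m).2.1) (fun m => (hdfacts m).2.2) hε0 (fun m => le_rfl) (u' := u') (v' := v')
    (fun m => canon_feed hv' E Λ0 m)
  -- the junk in closed form
  have hjunk := blockJunk_sum_le (r := fun m => ((Q₁ m : ℝ) + Q₂ m) / ((Q₂ m : ℝ) - Q₁ m)) (A := A) (τ := τ) (ε₀ := ε₀)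
    (rs := rs) (As := As) (τ₀ := τ₀) (e₀ := As * π * G * η * Λ0 / P.N j) (N := (P.N j : ℝ)) (Mδ := M * P.δ j)
    hN hMδ0.le (by
      have := (hτfacts 0).2; have := (hτfacts 0).1
      have h : τ 0 ≤ τ₀ / 2 ^ 0 := (hτfacts 0).2
      simp at h; linarith)
    (fun m => canon_r_nonneg (canon_Q₁_lt_Q₂ hv' hqd hsep (canon_blocks_ge Λ0 m)))
    (fun m => canon_r_le hv' hqd hsep (canon_blocks_ge Λ0 m)) (fun m => (hAfacts m).1) (fun m => (hAfacts m).2)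
    (fun m => (hτfacts m).1) (fun m => (hτfacts m).2) hε0 (fun m => ?_) Mb
  · -- assemble
    have e2N : ((2 * P.N j : ℕ) : ℝ) = 2 * (P.N j : ℝ) := by push_cast; ring
    rw [e2N] at hstep
    have e0 : Λb 0 = Λ0 := by simp [hΛb]
    rw [e0] at hstep
    exact le_add_sq_sqrt_add_mono hstep hjunk
  · -- the rounding allowance on block `m`
    simp only [hε₀]
    have hA' := (hAfacts m).2
    have hA0' := (hAfacts m).1.le
    have eΛ : ((Λb (m + 1) * G : ℕ) : ℝ) = (Λ0 : ℝ) * 2 ^ (m + 1) * G := by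
      show ((Λ0 * 2 ^ (m + 1) * G : ℕ) : ℝ) = _
      push_cast; ring
    rw [eΛ]
    have hAs0 : 0 ≤ As := hA0'.trans hA'
    calc A m * (2 * π * ((Λ0 : ℝ) * 2 ^ (m + 1) * G) * (Real.exp (-(M ^ 2 / 2)) / (2 * P.N j)))
        = A m * Real.exp (-(M ^ 2 / 2)) * (π * G * Λ0 / P.N j * 2 ^ (m + 1)) := by
          field_simp
      _ ≤ As * η * (π * G * Λ0 / P.N j * 2 ^ (m + 1)) :=
          mul_le_mul_of_nonneg_right (mul_le_mul hA' hMη (Real.exp_nonneg _) hAs0) (by positivity)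
      _ = As * π * G * η * Λ0 / P.N j * 2 ^ (m + 1) := by ring


end Cascade

end Summit.AnomalousDissipation.AnomalousDissipation.Theorems.SawtoothPulseCascade.K1Window
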